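import Literature.Analysis.FluidPDE.SteadyGalerkinApprox
import Literature.Analysis.FluidPDE.NSHopfGalerkinLimit
import HarnessLib

/-!
# Steady Navier–Stokes on `T^d`: compactness of the stationary Galerkin approximations

Trunk: FluidKinetic (`Literature/Analysis/FluidPDE`). Third step of the existence proof of steady
weak solutions of the forced Navier–Stokes equations on the flat torus by the Galerkin method
(Temam, *Navier–Stokes Equations* (1977/79), Ch. II, §1, Thm. 1.2, proof, part (ii): from the
bound (1.30) a subsequence `u_{m'} → u` weakly in `V` and — by the compactness of `V ↪ H` —
strongly in `H`; Constantin–Foias 1988, Ch. 8, (8.10)–(8.17) for the Fourier-side compactness on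
the torus). For the stationary Galerkin approximations of `SteadyGalerkinApprox` we extract a
subsequence along which every Fourier coefficient converges (Tychonoff on `∏_k B(0, M)`), build
the limit field `u ∈ L²(T^d; ℝ^d)` from the limit coefficients (Riesz–Fischer, real part), and
prove `u_N → u` **strongly in `L²`** from the uniform enstrophy bound (Friedrichs' inequality on
the Fourier side, `Torus.lintegral_enorm_sub_sq_le_sum_add`) together with Fatou's bound
`‖∇u‖² ≤ liminf ‖∇u_N‖²`.

## Contents (all proved)

* `exists_subseq_tendsto_of_norm_le` — bounded coefficient families `ℕ → ℤ^d → ℂ^d` have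
  coefficientwise convergent subsequences.
* `exists_realField_of_tsum_lt_top` — a conjugate-symmetric square-summable family is the
  Fourier coefficient family of a real `L²` field.
* `tendsto_lintegral_enorm_sub_sq_of_tendsto_mFourierCoeff` — coefficientwise convergence plus
  a uniform bound on `‖∇·‖²` give `∫ ‖U n - u‖² → 0` (Rellich/Friedrichs on the torus).
* `exists_steady_galerkin_limit` — **the limit of the stationary Galerkin approximations**:
  a strictly increasing `N_n`, smooth divergence-free mean-zero `U n` solving the `S_{N_n}`-Galerkin
  equations with the energy equation and the uniform bounds, and `u ∈ L²` with `Û n → û`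
  coefficientwise, `‖∇u‖² ≤ ‖f‖²/(4π²ν²)` and `∫ ‖U n - u‖² → 0`.

The identification of the limit as a steady weak solution is in `SteadyNavierStokesExistence`.

## Mathlib / tree search

Mathlib: `IsCompact.tendsto_subseq`, `isCompact_univ_pi`, `tendsto_pi_nhds`. Tree:
`exists_steady_galerkin_approx`, `steady_galerkin_bounds` (`SteadyGalerkinApprox`),
`Torus.lintegral_enorm_sub_sq_le_sum_add`, `eGradNormSq_le_liminf_of_tendsto_mFourierCoeff`,
`ENNReal.tsum_le_liminf_tsum` (`NSHopfLimit`),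
`exists_memLp_two_forall_mFourierCoeff_eq_of_tsum_lt_top`,
`mFourierCoeff_complexify_realPart_comp_of_isConjSymm` (`TorusSpaceTimeFields`),
`tsum_enorm_sq_mFourierCoeff_complexify` (`TorusVectorParseval`).

## References

* R. Temam, *Navier–Stokes Equations. Theory and Numerical Analysis*, North-Holland (1977;
  rev. ed. 1979), Ch. II, §1, Thm. 1.2 (proof, part (ii)). [Temam1979]
* P. Constantin, C. Foias, *Navier–Stokes Equations*, Univ. Chicago Press (1988), Ch. 8,
  (8.10)–(8.17). [ConstantinFoias1988]
-/

open MeasureTheory Set Filter UnitAddTorus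
open scoped ENNReal NNReal InnerProductSpace Topology

noncomputable section

namespace Literature.Analysis.FluidPDE

section NS

open FunctionSpaces FunctionSpaces.Torus Torus

variable {d : Type*} [Fintype d] [DecidableEq d]

/-! ### Compactness tools on the Fourier side -/

omit [DecidableEq d] in
/-- **Diagonal extraction**: a sequence of coefficient families `c n : ℤ^d → ℂ^d` bounded by `M`
at every frequency has a subsequence converging at every frequency (Tychonoff for
`∏_k B(0, M)` and sequential compactness in the first-countable product;
Constantin–Foias 1988, Ch. 8, proof of (8.10)). [folklore] -/
theorem exists_subseq_tendsto_of_norm_le {M : ℝ} {c : ℕ → (d → ℤ) → EuclideanSpace ℂ d}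
    (hc : ∀ n k, ‖c n k‖ ≤ M) :
    ∃ φ : ℕ → ℕ, StrictMono φ ∧ ∃ C : (d → ℤ) → EuclideanSpace ℂ d,
      ∀ k, Tendsto (fun j => c (φ j) k) atTop (𝓝 (C k)) := by
  set s : Set ((d → ℤ) → EuclideanSpace ℂ d) := Set.pi univ fun _ => Metric.closedBall 0 M with hs_def
  have hs : IsCompact s := isCompact_univ_pi fun _ => isCompact_closedBall _ _
  have hx : ∀ n, c n ∈ s := fun n k _ => mem_closedBall_zero_iff.2 (hc n k)
  obtain ⟨a, -, φ, hφ, hlim⟩ := hs.tendsto_subseq hx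
  exact ⟨φ, hφ, a, fun k => tendsto_pi_nhds.1 hlim k⟩

omit [DecidableEq d] in
/-- **Real `L²` fields with prescribed coefficients**: a conjugate-symmetric square-summable
family `C : ℤ^d → ℂ^d` is the Fourier coefficient family of a real field `u ∈ L²(T^d; ℝ^d)`
(Riesz–Fischer and the real part; Grafakos 2014, Prop. 3.2.7 (4)). [folklore] -/
theorem exists_realField_of_tsum_lt_top {C : (d → ℤ) → EuclideanSpace ℂ d} (hC : IsConjSymm C)
    (hsum : ∑' k, ‖C k‖ₑ ^ 2 < ⊤) :
    ∃ u : UnitAddTorus d → EuclideanSpace ℝ d, MemLp u 2 volume ∧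
      ∀ k, mFourierCoeff (EuclideanSpace.complexify ∘ u) k = C k := by
  obtain ⟨G, hG, hGC⟩ := exists_memLp_two_forall_mFourierCoeff_eq_of_tsum_lt_top (c := C) hsum
  refine ⟨fun x => EuclideanSpace.realPart (G x), ?_, fun k => ?_⟩
  · exact EuclideanSpace.realPart.comp_memLp' hG
  · exact mFourierCoeff_complexify_realPart_comp_of_isConjSymm (hG.integrable one_le_two) hC hGC k

/-- **Strong `L²` convergence from coefficientwise convergence and a uniform enstrophy bound**
(Rellich's compactness `H¹(T^d) ↪ L²(T^d)` in sequential, quantitative form; Temam 1979, Ch. II,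
proof of Thm. 1.2 (ii); Constantin–Foias 1988, Lemma 8.4/(8.16)): if `Û n (k) → û(k)` for every
`k` and `‖∇U n‖², ‖∇u‖² ≤ Λ < ∞`, then `∫ ‖U n - u‖² → 0`. Proof: split at frequency `R`
(`Torus.lintegral_enorm_sub_sq_le_sum_add`); the finitely many low modes converge, the tail is
`≤ 4Λ/(4π²R²)`. [cite: Temam1979, Ch. II Thm. 1.2 (proof (ii))] -/
theorem tendsto_lintegral_enorm_sub_sq_of_tendsto_mFourierCoeff
    {U : ℕ → UnitAddTorus d → EuclideanSpace ℝ d} {u : UnitAddTorus d → EuclideanSpace ℝ d}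
    (hU : ∀ n, MemLp (U n) 2 volume) (hu : MemLp u 2 volume) {Λ : ℝ≥0∞} (hΛ : Λ ≠ ⊤)
    (hgU : ∀ n, eGradNormSq (U n) ≤ Λ) (hgu : eGradNormSq u ≤ Λ)
    (hc : ∀ k, Tendsto (fun n => mFourierCoeff (EuclideanSpace.complexify ∘ U n) k) atTop
      (𝓝 (mFourierCoeff (EuclideanSpace.complexify ∘ u) k))) :
    Tendsto (fun n => ∫⁻ x, ‖U n x - u x‖ₑ ^ 2) atTop (𝓝 0) := by
  -- low modes
  have hlow : ∀ R : ℕ, Tendsto (fun n => ∑ k ∈ freqBall (d := d) R,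
      ‖mFourierCoeff (EuclideanSpace.complexify ∘ U n) k -
        mFourierCoeff (EuclideanSpace.complexify ∘ u) k‖ₑ ^ 2) atTop (𝓝 0) := by
    intro R
    have h0 : (0 : ℝ≥0∞) = ∑ k ∈ freqBall (d := d) R, (0 : ℝ≥0∞) := by simp
    rw [h0]
    refine tendsto_finsetSum _ fun k _ => ?_
    have h1 : Tendsto (fun n => mFourierCoeff (EuclideanSpace.complexify ∘ U n) k -
        mFourierCoeff (EuclideanSpace.complexify ∘ u) k) atTop (𝓝 0) := by
      simpa using (hc k).sub_const (mFourierCoeff (EuclideanSpace.complexify ∘ u) k)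
    have h2 : Tendsto (fun n => ‖mFourierCoeff (EuclideanSpace.complexify ∘ U n) k -
        mFourierCoeff (EuclideanSpace.complexify ∘ u) k‖ₑ ^ 2) atTop
        (𝓝 (‖(0 : EuclideanSpace ℂ d)‖ₑ ^ 2)) :=
      ((ENNReal.continuous_pow 2).tendsto _).comp h1.enorm
    simpa using h2
  rw [ENNReal.tendsto_nhds_zero]
  intro ε hε
  obtain ⟨δ, hδ, hδε⟩ : ∃ δ : ℝ, 0 < δ ∧ ENNReal.ofReal δ ≤ ε := by
    rcases eq_or_ne ε ⊤ with h | h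
    · exact ⟨1, one_pos, h ▸ le_top⟩
    · exact ⟨ε.toReal, ENNReal.toReal_pos hε.ne' h, (ENNReal.ofReal_toReal h).le⟩
  -- choose `R` with the tail `≤ δ/2`
  obtain ⟨R, hR⟩ := exists_nat_gt (max 1 (2 * (2 * Λ.toReal) / (4 * Real.pi ^ 2 * (δ / 2))))
  have hR1 : 1 ≤ R := by
    have : (1 : ℝ) < R := lt_of_le_of_lt (le_max_left _ _) hR
    exact_mod_cast this.le
  have h1R : (1 : ℝ) ≤ R := by exact_mod_cast hR1
  have hRpos : (0 : ℝ) < R := lt_of_lt_of_le one_pos h1R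
  have htailR : ENNReal.ofReal (2 / (4 * Real.pi ^ 2 * (R : ℝ) ^ 2)) * (Λ + Λ) ≤
      ENNReal.ofReal (δ / 2) := by
    rw [← ENNReal.ofReal_toReal hΛ, ← ENNReal.ofReal_add ENNReal.toReal_nonneg
      ENNReal.toReal_nonneg, ← ENNReal.ofReal_mul (by positivity)]
    refine ENNReal.ofReal_le_ofReal ?_
    have h1 : 2 * (2 * Λ.toReal) / (4 * Real.pi ^ 2 * (δ / 2)) < R :=
      lt_of_le_of_lt (le_max_right _ _) hR
    have h2 : (R : ℝ) ≤ (R : ℝ) ^ 2 := by nlinarith [mul_le_mul_of_nonneg_left h1R hRpos.le]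
    rw [div_mul_eq_mul_div, div_le_iff₀ (by positivity)]
    rw [div_lt_iff₀ (by positivity)] at h1
    have hD0 : 0 ≤ Λ.toReal := ENNReal.toReal_nonneg
    nlinarith [Real.pi_pos, mul_le_mul_of_nonneg_left h2
      (show 0 ≤ 4 * Real.pi ^ 2 * (δ / 2) by positivity)]
  have hlowR := ENNReal.tendsto_nhds_zero.1 (hlow R) (ENNReal.ofReal (δ / 2))
    (ENNReal.ofReal_pos.2 (by positivity))
  filter_upwards [hlowR] with n hn
  calc ∫⁻ x, ‖U n x - u x‖ₑ ^ 2
      ≤ (∑ k ∈ freqBall R, ‖mFourierCoeff (EuclideanSpace.complexify ∘ U n) k -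
            mFourierCoeff (EuclideanSpace.complexify ∘ u) k‖ₑ ^ 2) +
          ENNReal.ofReal (2 / (4 * Real.pi ^ 2 * (R : ℝ) ^ 2)) * (eGradNormSq (U n) + eGradNormSq u) :=
        Torus.lintegral_enorm_sub_sq_le_sum_add (hU n) hu hR1
    _ ≤ ENNReal.ofReal (δ / 2) + ENNReal.ofReal (2 / (4 * Real.pi ^ 2 * (R : ℝ) ^ 2)) * (Λ + Λ) :=
        add_le_add hn (mul_le_mul_of_nonneg_left (add_le_add (hgU n) hgu) bot_le)
    _ ≤ ENNReal.ofReal (δ / 2) + ENNReal.ofReal (δ / 2) := add_le_add le_rfl htailR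
    _ = ENNReal.ofReal δ := by rw [← ENNReal.ofReal_add (by positivity) (by positivity), add_halves]
    _ ≤ ε := hδε

omit [DecidableEq d] in
/-- Fourier coefficients of a real trigonometric polynomial whose coefficient family is
supported in the (symmetric) frequency set: `𝓕(realTrigPoly S C) = C` everywhere. [folklore] -/
theorem mFourierCoeff_realTrigPoly_of_support {S : Finset (d → ℤ)} (hS : ∀ k ∈ S, -k ∈ S)
    {C : (d → ℤ) → EuclideanSpace ℂ d} (hC : IsConjSymm C) (hsupp : ∀ k ∉ S, C k = 0)
    (k : d → ℤ) : mFourierCoeff (EuclideanSpace.complexify ∘ realTrigPoly S C) k = C k := by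
  rw [mFourierCoeff_realTrigPoly hS hC]
  by_cases hk : k ∈ S
  · rw [if_pos hk]
  · rw [if_neg hk, hsupp k hk]

/-! ### The limit of the stationary Galerkin approximations -/

/-- **Compactness of the stationary Galerkin approximations** (Temam 1979, Ch. II, §1, proof of
Thm. 1.2, part (ii); Constantin–Foias 1988, Ch. 8, (8.10)–(8.17)). Let `ν > 0` and
`f ∈ L²(T^d; ℝ^d)`, and put `Λ = (∫ ‖f‖²)/(4π²ν)²`. There are a strictly increasing sequence of
orders `N n`, smooth divergence-free mean-zero fields `U n` (the stationary Galerkin solutions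
on the punctured balls `S_{N n}`, `exists_steady_galerkin_approx`) and a field `u ∈ L²` with:
the uniform bounds `‖∇U n‖² ≤ 4π²Λ`, `∫ ‖U n‖² ≤ Λ`; the energy equation
`ν ‖∇U n‖² = ∫ ⟪f, U n⟫`; the Galerkin equations
`∫ (⟪U n, (U n·∇)a⟫ + ν ⟪U n, Δa⟫ + ⟪f, a⟫) = 0` for smooth divergence-free `a` band-limited to
`S_{N n}`; coefficientwise convergence `Û n (k) → û(k)`; Fatou's bound `‖∇u‖² ≤ 4π²Λ`; and the
strong convergence `∫ ‖U n - u‖² → 0`. [cite: Temam1979, Ch. II Thm. 1.2 (proof (ii))] -/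
theorem exists_steady_galerkin_limit {ν : ℝ} (hν : 0 < ν)
    {f : UnitAddTorus d → EuclideanSpace ℝ d} (hf : MemLp f 2 volume) :
    ∃ (N : ℕ → ℕ) (U : ℕ → UnitAddTorus d → EuclideanSpace ℝ d)
      (u : UnitAddTorus d → EuclideanSpace ℝ d),
      StrictMono N ∧
      (∀ n, IsSmooth (U n)) ∧ (∀ n, IsDivFree (U n)) ∧ (∀ n, HasZeroMean (U n)) ∧
      (∀ n, eGradNormSq (U n) ≤
        ENNReal.ofReal (4 * Real.pi ^ 2 * ((∫ x, ‖f x‖ ^ 2) / (4 * Real.pi ^ 2 * ν) ^ 2))) ∧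
      (∀ n, ∫ x, ‖U n x‖ ^ 2 ≤ (∫ x, ‖f x‖ ^ 2) / (4 * Real.pi ^ 2 * ν) ^ 2) ∧
      (∀ n, ν * (eGradNormSq (U n)).toReal = ∫ x, ⟪f x, U n x⟫_ℝ) ∧
      (∀ n (a : UnitAddTorus d → EuclideanSpace ℝ d), IsSmooth a → IsDivFree a →
        (∀ k ∉ (freqBall (d := d) (N n)).erase 0,
          mFourierCoeff (EuclideanSpace.complexify ∘ a) k = 0) →
        ∫ x, (⟪U n x, FunctionSpaces.Torus.convect (U n) a x⟫_ℝ +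
          ν * ⟪U n x, FunctionSpaces.Torus.laplacian a x⟫_ℝ + ⟪f x, a x⟫_ℝ) = 0) ∧
      MemLp u 2 volume ∧
      (∀ k, Tendsto (fun n => mFourierCoeff (EuclideanSpace.complexify ∘ U n) k) atTop
        (𝓝 (mFourierCoeff (EuclideanSpace.complexify ∘ u) k))) ∧
      eGradNormSq u ≤
        ENNReal.ofReal (4 * Real.pi ^ 2 * ((∫ x, ‖f x‖ ^ 2) / (4 * Real.pi ^ 2 * ν) ^ 2)) ∧
      Tendsto (fun n => ∫⁻ x, ‖U n x - u x‖ₑ ^ 2) atTop (𝓝 0) := by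
  -- the Galerkin solutions at every order
  choose C hCsymm hCT hCsupp hCbd hCen hCgal using fun M => exists_steady_galerkin_approx hν hf M
  set Λ : ℝ := (∫ x, ‖f x‖ ^ 2) / (4 * Real.pi ^ 2 * ν) ^ 2 with hΛ
  have hΛ0 : 0 ≤ Λ := div_nonneg (integral_nonneg fun x => sq_nonneg _) (sq_nonneg _)
  have hS : ∀ M : ℕ, ∀ k ∈ (freqBall (d := d) M).erase 0, -k ∈ (freqBall (d := d) M).erase 0 :=
    fun M => neg_mem_freqBall_erase_zero
  have hS0 : ∀ M : ℕ, (0 : d → ℤ) ∉ (freqBall (d := d) M).erase 0 := fun M => by simp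
  have hbds := fun M => steady_galerkin_bounds (N := M) hν (hCsymm M) (hCsupp M) (hCbd M)
  -- pointwise coefficient bound and extraction
  have hptw : ∀ M k, ‖C M k‖ ≤ Real.sqrt Λ := fun M k => by
    have h := (hbds M).2.2 k
    have := Real.abs_le_sqrt h
    rwa [abs_of_nonneg (norm_nonneg _)] at this
  obtain ⟨φ, hφ, Cl, hCl⟩ := exists_subseq_tendsto_of_norm_le hptw
  -- the limit coefficients are conjugate symmetric and square summable
  have hClsymm : IsConjSymm Cl := by
    intro k
    have h1 : Tendsto (fun j => C (φ j) (-k)) atTop (𝓝 (EuclideanSpace.conjVec (Cl k))) := by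
      have h2 : Tendsto (fun j => EuclideanSpace.conjVecL (C (φ j) k)) atTop
          (𝓝 (EuclideanSpace.conjVecL (Cl k))) :=
        (EuclideanSpace.conjVecL.continuous.tendsto _).comp (hCl k)
      simp only [EuclideanSpace.conjVecL_apply] at h2
      refine h2.congr fun j => ?_
      exact ((hCsymm (φ j)) k).symm
    exact tendsto_nhds_unique (hCl (-k)) h1
  have hcoefU : ∀ j k, mFourierCoeff (EuclideanSpace.complexify ∘
      realTrigPoly ((freqBall (d := d) (φ j)).erase 0) (C (φ j))) k = C (φ j) k :=
    fun j k => mFourierCoeff_realTrigPoly_of_support (hS _) (hCsymm _) (hCsupp _) k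
  have hUmem : ∀ j, MemLp (realTrigPoly ((freqBall (d := d) (φ j)).erase 0) (C (φ j))) 2 volume :=
    fun j => memLp_realTrigPoly _ _ 2
  have hsumU : ∀ j, ∑' k, ‖C (φ j) k‖ₑ ^ 2 ≤ ENNReal.ofReal Λ := by
    intro j
    have h := tsum_enorm_sq_mFourierCoeff_complexify (hUmem j)
    simp_rw [hcoefU j] at h
    rw [h, Torus.lintegral_enorm_sq_eq_ofReal (hUmem j)]
    exact ENNReal.ofReal_le_ofReal (hbds (φ j)).2.1
  have hsumCl : ∑' k, ‖Cl k‖ₑ ^ 2 ≤ ENNReal.ofReal Λ := by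
    refine (ENNReal.tsum_le_liminf_tsum fun k =>
      ((ENNReal.continuous_pow 2).tendsto _).comp (hCl k).enorm).trans ?_
    calc liminf (fun j => ∑' k, ‖C (φ j) k‖ₑ ^ 2) atTop ≤ liminf (fun _ : ℕ => ENNReal.ofReal Λ) atTop :=
          liminf_le_liminf (Eventually.of_forall hsumU)
      _ = ENNReal.ofReal Λ := liminf_const _
  -- the limit field
  obtain ⟨u, hu, huC⟩ := exists_realField_of_tsum_lt_top hClsymm
    (lt_of_le_of_lt hsumCl ENNReal.ofReal_lt_top)
  have hconv : ∀ k, Tendsto (fun j => mFourierCoeff (EuclideanSpace.complexify ∘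
      realTrigPoly ((freqBall (d := d) (φ j)).erase 0) (C (φ j))) k) atTop
      (𝓝 (mFourierCoeff (EuclideanSpace.complexify ∘ u) k)) := by
    intro k
    simp_rw [hcoefU, huC]
    exact hCl k
  -- Fatou for the enstrophy of the limit
  have hgradU : ∀ j, eGradNormSq (realTrigPoly ((freqBall (d := d) (φ j)).erase 0) (C (φ j))) ≤
      ENNReal.ofReal (4 * Real.pi ^ 2 * Λ) := fun j => (hbds (φ j)).1
  have hgradu : eGradNormSq u ≤ ENNReal.ofReal (4 * Real.pi ^ 2 * Λ) := by
    have h := eGradNormSq_le_liminf_of_tendsto_mFourierCoeff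
      (U := fun j (_ : ℝ) => realTrigPoly ((freqBall (d := d) (φ j)).erase 0) (C (φ j)))
      (u := fun _ : ℝ => u) (fun _ _ k => hconv k) (t := 0) le_rfl
    refine h.trans ?_
    calc liminf (fun j => eGradNormSq (realTrigPoly ((freqBall (d := d) (φ j)).erase 0) (C (φ j)))) atTop
        ≤ liminf (fun _ : ℕ => ENNReal.ofReal (4 * Real.pi ^ 2 * Λ)) atTop :=
          liminf_le_liminf (Eventually.of_forall hgradU)
      _ = ENNReal.ofReal (4 * Real.pi ^ 2 * Λ) := liminf_const _
  refine ⟨φ, fun j => realTrigPoly ((freqBall (d := d) (φ j)).erase 0) (C (φ j)), u, hφ,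
    fun j => isSmooth_realTrigPoly _ _,
    fun j => isDivFree_realTrigPoly fun k hk => ?_,
    fun j => hasZeroMean_realTrigPoly_of_zero_not_mem (hS0 _) _,
    hgradU, fun j => (hbds (φ j)).2.1, fun j => hCen (φ j), fun j a ha hdiv hband => hCgal (φ j) a ha hdiv hband,
    hu, hconv, hgradu,
    tendsto_lintegral_enorm_sub_sq_of_tendsto_mFourierCoeff hUmem hu ENNReal.ofReal_ne_top hgradU
      hgradu hconv⟩
  exact hCT (φ j) k

end NS

end Literature.Analysis.FluidPDE
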